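import Literature.NumberTheory.Kottwitz1992.InvolutionsLemma28Holds
import Literature.NumberTheory.Kottwitz1992.InvolutionsLemma23cHolds
import Mathlib.LinearAlgebra.QuadraticForm.Basic
import Mathlib.LinearAlgebra.BilinearForm.Orthogonal
import HarnessLib

/-!
# [Kottwitz1992, Lemma 2.9 p. 381] Positive elements of a stable semisimple subalgebra: `C₊ = C ∩ B₊` — DISCHARGED:
# `Kottwitz1992_2_9_posElts_subalgebra_holds`

Kernel-lane companion of the statement carpet ★ `Literature/NumberTheory/Kottwitz1992/Involutions.lean` (squad TK; builds on ★
`InvolutionsLemma28Holds` (Lemma 2.8), ★ `InvolutionsLemma27Holds` (Lemma 2.7 and the Notation remark), ★ `InvolutionsLemma23cHolds`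
(Lemma 2.3 (3))): the named fact ★ `Involutions.Kottwitz1992_2_9_posElts_subalgebra` — «Suppose that `*` is a positive involution leaving
stable a semisimple subalgebra `C` of `B`.  Then `C₊ = C ∩ B₊`» (the subalgebra presented by an injective intertwining `f : C → B`:
`f(C₊) = f(C) ∩ B₊`) — is PROVED here.  THEOREMS ONLY (no definition, no named fact, no `sorry`, no instance, no notation); cell
hodgecm-mathlib, seat B-typ02 (g31); net debt −1.

R. E. Kottwitz, *Points on some Shimura varieties over finite fields*, J. Amer. Math. Soc. 5 (1992), Lemma 2.9 p. 381, proof p. 382 L1–L11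
(held `paper:doi-10-2307-2152772`, p0009 L49–L50, p0010 L5–L15).  THE PRINTED PROOF: «Let `c ∈ C₊`.  Then `c = dd*` for some `d ∈ C^×`.
Therefore `c ∈ B₊`.  To prove the reverse inclusion we start with an element `c ∈ C ∩ B₊`.  We want to show that `c ∈ C₊`; for this it is
enough to check that `tr_{C/ℝ} xcx*` is positive for all nonzero `x ∈ C`.  Since `c` is invertible in `B`, it is invertible in `C`; therefore,
`tr_{C/ℝ} xcy*` is a nondegenerate symmetric bilinear form, and it is enough to show that `tr_{C/ℝ} xcx*` is nonnegative for all `x ∈ C`.  Let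
`y = xcx*`.  There exists `b ∈ B^×` such that `c = bb*`.  Therefore `y = xb(xb)*`.  It follows that left multiplication by `y` on `B` is
selfadjoint with nonnegative eigenvalues (take the adjoint with respect to the form `tr_{B/ℝ}(xy*)` on `B`).  Moreover left multiplication by
`y` preserves the subspace `C` of `B`, and hence has nonnegative eigenvalues on `C`.  Therefore `tr_{C/ℝ} y` is nonnegative.»  Followed step by
step: `C₊ = {dd*}` and `bb* ∈ B₊` are ★ Lemma 2.8 for `C` (positive by ★ Lemma 2.3 (3)) and for `B`; «invertible in `C`» by finite
dimension; «nondegenerate symmetric» is the ★ Notation remark (`Kottwitz1992_2_trForm_symm_alt_nondegenerate`); «nonnegative eigenvalues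
on `C` ⇒ `tr ≥ 0`» is computed as the trace of the restriction of the positive semidefinite `L_y` in an orthogonal basis of `f(C)` for the
positive definite form `tr_{B/ℝ}(xy*)` (symmetric by ★ Lemma 2.7); «nonnegative + nondegenerate symmetric ⇒ positive» closes (§1).
HONEST LABEL: HC_CM is proved only modulo the 7 printed citations (2 remaining: hLiu418, h413) until rung 0 closes; this file adds no citation
debt (0 facts, 0 sorry) and discharges 1 named fact of ★ `Involutions`.

## References
* [Kottwitz1992] R. E. Kottwitz, Points on some Shimura varieties over finite fields, J. Amer. Math. Soc. 5 (1992) 373–444, Lemma 2.9 p. 381–382.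
-/

namespace Literature.NumberTheory.Kottwitz1992.Involutions

open Literature.NumberTheory.Automorphic (leftMulTrace leftMulTrace_apply)

universe u

variable {B : Type u} [Ring B] [Algebra ℝ B] (ι : B →ₗ[ℝ] B)

/-! ## §1 «selfadjoint with nonnegative eigenvalues … hence nonnegative trace on an invariant subspace» -/

omit ι in
/-- For a positive definite symmetric form `τ` on `V` and an endomorphism `T` with `τ(Tu, u) ≥ 0` for all `u` («nonnegative eigenvalues»),
the trace of `T` on a `T`-stable subspace `W` is `≥ 0`: in a `τ`-orthogonal basis `(eᵢ)` of `W` it is `∑ᵢ τ(eᵢ, T eᵢ)/τ(eᵢ, eᵢ)`.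
[cite: Kottwitz1992, Lemma 2.9 (p. 382)] -/
private theorem trace_restrict_nonneg {V : Type u} [AddCommGroup V] [Module ℝ V] [FiniteDimensional ℝ V]
    (τ : LinearMap.BilinForm ℝ V) (hsymm : ∀ u v, τ u v = τ v u) (hpos : ∀ u, u ≠ 0 → 0 < τ u u)
    (T : V →ₗ[ℝ] V) (hT : ∀ u, 0 ≤ τ (T u) u) (W : Submodule ℝ V) (hW : ∀ w ∈ W, T w ∈ W) :
    0 ≤ LinearMap.trace ℝ W (T.restrict hW) := by
  haveI : Invertible (2 : ℝ) := invertibleOfNonzero two_ne_zero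
  let τW : LinearMap.BilinForm ℝ W := τ.comp W.subtype W.subtype
  have hτW : ∀ v w : W, τW v w = τ (v : V) (w : V) := fun v w => rfl
  obtain ⟨b, hb⟩ := LinearMap.BilinForm.exists_orthogonal_basis (B := τW) ⟨fun v w => hsymm _ _⟩
  have hd : ∀ i, 0 < τW (b i) (b i) := fun i => hpos _ fun h => b.ne_zero i (Subtype.ext h)
  have hcoord : ∀ (v : W) (i), τW (b i) v = b.repr v i * τW (b i) (b i) := fun v i => by
    conv_lhs => rw [← b.sum_repr v]
    rw [map_sum]
    simp_rw [map_smul, smul_eq_mul]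
    rw [Finset.sum_eq_single i (fun j _ hji => ?_) (fun h => (h (Finset.mem_univ i)).elim)]
    rw [LinearMap.isOrthoᵢ_def.1 hb i j (Ne.symm hji), mul_zero]
  rw [LinearMap.trace_eq_matrix_trace ℝ b]
  simp only [Matrix.trace, Matrix.diag_apply, LinearMap.toMatrix_apply]
  refine Finset.sum_nonneg fun i _ => ?_
  have h : b.repr (T.restrict hW (b i)) i = τW (b i) (T.restrict hW (b i)) / τW (b i) (b i) := by
    rw [eq_div_iff (hd i).ne', ← hcoord]
  rw [h]
  refine div_nonneg ?_ (hd i).le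
  rw [hτW, LinearMap.coe_restrict_apply, hsymm]
  exact hT _

omit ι in
/-- `tr_{B/ℝ}(x y) = tr_{B/ℝ}(y x)`. [cite: Kottwitz1992, Lemma 2.2 (p. 379)] -/
private theorem leftMulTrace_comm (x y : B) : leftMulTrace ℝ B (x * y) = leftMulTrace ℝ B (y * x) := by
  rw [leftMulTrace_apply, leftMulTrace_apply, map_mul (Algebra.lmul ℝ B), map_mul (Algebra.lmul ℝ B),
    LinearMap.trace_mul_comm]

/-! ## §2 The discharge -/

variable (C : Type u) [Ring C] [Algebra ℝ C] (ιC : C →ₗ[ℝ] C) (f : C →ₐ[ℝ] B)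

/-- **LEMMA 2.9, PROVED**: ★ `Kottwitz1992_2_9_posElts_subalgebra` holds — `f(C₊) = f(C) ∩ B₊`: `⊆` by `c = dd*` (★ Lemma 2.8 for `C`, positive
by ★ Lemma 2.3 (3)) and `f(d)f(d)* ∈ B₊` (★ Lemma 2.8 for `B`); `⊇` because for `f(c) = bb* ∈ B₊` the form `tr_{C/ℝ}(x c y*)` is symmetric and
nondegenerate (`c ∈ C^×`, ★ Notation remark) and nonnegative (`tr_{C/ℝ}(xcx*)` is the trace on `f(C)` of the positive semidefinite
`L_{f(x)b(f(x)b)*}`, §1), hence positive definite. [cite: Kottwitz1992, Lemma 2.9 (p. 381–382)] -/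
theorem Kottwitz1992_2_9_posElts_subalgebra_holds : Kottwitz1992_2_9_posElts_subalgebra B ι C ιC f := by
  intro hA hP hC hf hcomp
  haveI := hA.finiteDimensional
  have hI : IsInvolution ℝ B ι := hP.toIsInvolution
  haveI : FiniteDimensional ℝ C := Module.Finite.of_injective f.toLinearMap hf
  have hPC : IsPositiveInvolution C ιC := Kottwitz1992_2_3_3_subalgebra_holds ι C ιC f hA hP hC hf hcomp
  have hIC : IsInvolution ℝ C ιC := hPC.toIsInvolution
  have hAC : IsAlgebraWithInvolution C ιC := ⟨inferInstance, hC, hIC⟩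
  -- Lemma 2.8: `B₊ = {bb*}`, `C₊ = {dd*}`
  have h8B : posElts ι = {x | ∃ b : Bˣ, x = (b : B) * ι b} :=
    (Kottwitz1992_2_8_posElts_cone_transitive_holds B ι hA hP).2.2.2.2.2.2
  have h8C : posElts ιC = {x | ∃ d : Cˣ, x = (d : C) * ιC d} :=
    (Kottwitz1992_2_8_posElts_cone_transitive_holds C ιC hAC hPC).2.2.2.2.2.2
  apply Set.Subset.antisymm
  · -- «Let `c ∈ C₊`.  Then `c = dd*` for some `d ∈ C^×`.  Therefore `c ∈ B₊`.»
    rintro _ ⟨c, hc, rfl⟩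
    refine ⟨⟨c, rfl⟩, ?_⟩
    rw [h8C] at hc
    obtain ⟨d, hd⟩ := hc
    rw [h8B]
    refine ⟨Units.map (f : C →* B) d, ?_⟩
    rw [hd, map_mul, hcomp, Units.coe_map, MonoidHom.coe_coe]
  · -- «To prove the reverse inclusion we start with an element `c ∈ C ∩ B₊`.»
    rintro _ ⟨⟨c, rfl⟩, hy⟩
    refine ⟨c, ?_, rfl⟩
    have hsym : ιC c = c := hf (by rw [hcomp]; exact hy.1)
    have hb' : f c ∈ {x | ∃ b : Bˣ, x = (b : B) * ι b} := h8B ▸ hy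
    obtain ⟨b, hb⟩ := hb'
    -- `ι` of a unit is a unit (`ι 1 = 1`)
    have h1 : ι (1 : B) = 1 := by
      have h := hI.map_mul (ι 1) 1
      rw [mul_one, hI.apply_apply, mul_one] at h
      exact h.symm
    have hιu : IsUnit (ι (b : B)) :=
      ⟨⟨ι (b : B), ι (b⁻¹ : Bˣ), by rw [← hI.map_mul, Units.inv_mul, h1], by rw [← hI.map_mul, Units.mul_inv, h1]⟩, rfl⟩
    have hfc : IsUnit (f c) := by rw [hb]; exact (Units.isUnit b).mul hιu
    -- «Since `c` is invertible in `B`, it is invertible in `C`» (finite dimension)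
    have hcunit : IsUnit c := by
      have hinjL : Function.Injective (LinearMap.mulLeft ℝ c) := fun x x' h => by
        have h' : f c * f x = f c * f x' := by
          have := congrArg f h
          simpa [map_mul] using this
        exact hf (hfc.mul_left_cancel h')
      have hinjR : Function.Injective (LinearMap.mulRight ℝ c) := fun x x' h => by
        have h' : f x * f c = f x' * f c := by
          have := congrArg f h
          simpa [map_mul] using this
        exact hf (hfc.mul_right_cancel h')
      obtain ⟨x₁, hx₁⟩ := (LinearMap.injective_iff_surjective.1 hinjL) 1
      obtain ⟨x₂, hx₂⟩ := (LinearMap.injective_iff_surjective.1 hinjR) 1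
      have hx₁' : c * x₁ = 1 := hx₁
      have hx₂' : x₂ * c = 1 := hx₂
      have heq : x₂ = x₁ := by
        calc x₂ = x₂ * (c * x₁) := by rw [hx₁', mul_one]
          _ = x₁ := by rw [← mul_assoc, hx₂', one_mul]
      exact ⟨⟨c, x₁, hx₁', heq ▸ hx₂'⟩, rfl⟩
    -- «`tr_{C/ℝ} xcy*` is a nondegenerate symmetric bilinear form»
    have hq := Kottwitz1992_2_trForm_symm_alt_nondegenerate_holds C ιC hAC c
    have hqsymm : ∀ x y : C, trForm ιC c x y = trForm ιC c y x := hq.1.2 hsym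
    have hqnd : ∀ x : C, (∀ y : C, trForm ιC c x y = 0) → x = 0 := hq.2.2.2 hcunit
    -- the positive definite symmetric form `τ(u, v) = tr_{B/ℝ}(u v*)` on `B` (Lemma 2.2 (3), Lemma 2.7)
    have h27 : ∀ z : B, leftMulTrace ℝ B (ι z) = leftMulTrace ℝ B z := fun z =>
      ((Kottwitz1992_2_7_trace_eq_holds B ι hA z).2).symm
    obtain ⟨τ, hτ⟩ : ∃ τ : LinearMap.BilinForm ℝ B, ∀ u v, τ u v = leftMulTrace ℝ B (u * ι v) :=
      ⟨LinearMap.mk₂ ℝ (fun u v => leftMulTrace ℝ B (u * ι v))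
        (fun _ _ _ => by simp only [add_mul, map_add])
        (fun _ _ _ => by simp only [smul_mul_assoc, map_smul])
        (fun _ _ _ => by simp only [map_add, mul_add])
        (fun _ _ _ => by simp only [map_smul, mul_smul_comm]), fun _ _ => rfl⟩
    have hτsymm : ∀ u v, τ u v = τ v u := fun u v => by
      rw [hτ, hτ, ← h27 (v * ι u), hI.map_mul, hI.apply_apply]
    have hτpos : ∀ u, u ≠ 0 → 0 < τ u u := fun u hu => by rw [hτ]; exact hP.trace_mul_self_pos u hu
    have hτnn : ∀ u, 0 ≤ τ u u := fun u => by
      by_cases hu : u = 0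
      · rw [hu]; simp
      · exact (hτpos u hu).le
    -- «left multiplication by `y = a a*` on `B` is selfadjoint with nonnegative eigenvalues»
    have hTpsd : ∀ a u : B, 0 ≤ τ (Algebra.lmul ℝ B (a * ι a) u) u := fun a u => by
      have h : τ (Algebra.lmul ℝ B (a * ι a) u) u = τ (ι a * u) (ι a * u) := by
        rw [hτ, hτ, hI.map_mul, hI.apply_apply]
        show leftMulTrace ℝ B (a * ι a * u * ι u) = _
        rw [show a * ι a * u * ι u = a * (ι a * u * ι u) by simp only [mul_assoc], leftMulTrace_comm]
        simp only [mul_assoc]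
      rw [h]
      exact hτnn _
    -- «left multiplication by `y` preserves the subspace `C` of `B`»: `tr_{C/ℝ}(y)` is a trace on `f(C)`
    let W : Submodule ℝ B := LinearMap.range f.toLinearMap
    have hWmaps : ∀ (y : C), ∀ w ∈ W, Algebra.lmul ℝ B (f y) w ∈ W := fun y w hw => by
      obtain ⟨z, rfl⟩ := hw
      exact ⟨y * z, by simp [map_mul]⟩
    have htrC : ∀ y : C, leftMulTrace ℝ C y = LinearMap.trace ℝ W ((Algebra.lmul ℝ B (f y)).restrict (hWmaps y)) := by
      intro y
      have hinj : Function.Injective f.toLinearMap := hf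
      let e := LinearEquiv.ofInjective f.toLinearMap hinj
      rw [leftMulTrace_apply, ← LinearMap.trace_conj' (Algebra.lmul ℝ C y) e]
      congr 1
      refine LinearMap.ext fun w => Subtype.ext ?_
      obtain ⟨z, hz⟩ : ∃ z, f.toLinearMap z = (w : B) := w.2
      have hes : e.symm w = z := by
        rw [LinearEquiv.symm_apply_eq]
        exact Subtype.ext (by rw [LinearEquiv.ofInjective_apply]; exact hz.symm)
      rw [LinearEquiv.conj_apply_apply, LinearMap.coe_restrict_apply, hes, LinearEquiv.ofInjective_apply, ← hz]
      show f (y * z) = f y * f z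
      exact map_mul f y z
    -- «Therefore `tr_{C/ℝ} y` is nonnegative»
    have hpsd : ∀ x : C, 0 ≤ trForm ιC c x x := fun x => by
      show 0 ≤ leftMulTrace ℝ C (x * c * ιC x)
      rw [htrC]
      refine trace_restrict_nonneg τ hτsymm hτpos _ (fun u => ?_) W (hWmaps _)
      have hfy : f (x * c * ιC x) = (f x * (b : B)) * ι (f x * (b : B)) := by
        rw [map_mul, map_mul, hcomp, hb, hI.map_mul]
        simp only [mul_assoc]
      rw [hfy]
      exact hTpsd _ _
    -- «nonnegative + nondegenerate symmetric ⇒ positive»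
    refine ⟨hsym, fun x hx => ?_⟩
    rcases (hpsd x).lt_or_eq with hlt | heq
    · exact hlt
    · exfalso
      apply hx
      refine hqnd x fun v => ?_
      -- expand `0 ≤ q(x + t v, x + t v) = 2 t q(x, v) + t² q(v, v)` for all real `t`
      have hexp : ∀ t : ℝ, trForm ιC c (x + t • v) (x + t • v) =
          trForm ιC c x x + t * trForm ιC c x v + t * trForm ιC c v x + t * t * trForm ιC c v v := by
        intro t
        simp only [trForm, map_add, map_smul, add_mul, mul_add, smul_mul_assoc, mul_smul_comm, smul_add, smul_eq_mul]
        ring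
      have hineq : ∀ t : ℝ, 0 ≤ 2 * t * trForm ιC c x v + t * t * trForm ιC c v v := fun t => by
        have h := hpsd (x + t • v)
        rw [hexp, ← heq, ← hqsymm x v] at h
        linarith
      set β := trForm ιC c x v
      set γ := trForm ιC c v v
      have hγ : 0 ≤ γ := hpsd v
      rcases hγ.lt_or_eq with hγpos | hγ0
      · have h := hineq (-β / γ)
        have hcalc : 2 * (-β / γ) * β + -β / γ * (-β / γ) * γ = -(β ^ 2 / γ) := by
          field_simp
          ring
        rw [hcalc] at h
        have hnn : 0 ≤ β ^ 2 / γ := div_nonneg (sq_nonneg β) hγ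
        have hzero : β ^ 2 / γ = 0 := le_antisymm (by linarith) hnn
        rw [div_eq_zero_iff] at hzero
        rcases hzero with h0 | h0
        · exact (pow_eq_zero_iff two_ne_zero).1 h0
        · exact absurd h0 hγpos.ne'
      · have h := hineq (-β)
        rw [← hγ0, mul_zero, add_zero] at h
        nlinarith [sq_nonneg β]

end Literature.NumberTheory.Kottwitz1992.Involutions
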